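import Summits.RiemannHypothesis.RiemannHypothesis.Theorems.ScrewSquaringLawDyadicLandauAbscissa
import Summits.RiemannHypothesis.RiemannHypothesis.Theorems.ScrewSquaringLawDyadicLandauDoubling
import Summits.RiemannHypothesis.RiemannHypothesis.Theses.ScrewSquaringLaw
import HarnessLib

/-!
# Crux `ScrewSquaringLaw.DyadicLandau` (stmt-RiemannHypothesis-23894) — dyadic Landau detection for
Suzuki's screw function (RH-free criterion, K1 of route `ScrewSquaringLaw`, L45)

**Theorem (`DyadicLandau_proof`).** If the doubling defect of Suzuki's screw function `Ψ = zetaScrew`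
(Suzuki 2023, arXiv:2206.03682, (1.1)) is bounded below on `[0, ∞)`, `Ψ(2t) ≤ 4Ψ(t) + K` for all
`t ≥ 0`, then the Riemann Hypothesis holds.

This is an RH-CRITERION, not a proof of RH: the hypothesis is RH-implied (termwise
`4(1 − cos γt) − (1 − cos 2γt) = 2(1 − cos γt)² ≥ 0` in Suzuki's Thm 1.1 (2)) and, given this theorem,
RH-equivalent (route items `SquaringNodes`, `SquaringLaw` are the residual conjuncts).  RH is NOT proved
by this file; nothing here bears on the truth of RH.

**Proof** = the registered line «DoublingChain» (planner rh-idea-7 g2; lead prover's skeleton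
`Cruxes/DyadicLandau/…`), both stubs landed:
* `ScrewSquaringLaw.stub_landauAbscissa` (`Theorems/ScrewSquaringLawDyadicLandauAbscissa.lean`):
  Landau's lemma for the non-negative function `4Ψ(log x) − Ψ(2 log x) + K`, whose transform
  `4R(s) − ½R(s/2) + K/s` (`R(s) = s⁻²(ξ'/ξ)(½+s)`, `Theorems/ScrewSquaringLawDyadicLandauMellin.lean`)
  is holomorphic near the real ray, gives absolute convergence at every `σ > 0`;
* `ScrewSquaringLaw.stub_doubling` (`Theorems/ScrewSquaringLawDyadicLandauDoubling.lean`): the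
  transform is then holomorphic on `Re s > 0`, and the order count in
  `F s² ξ(½+s)ξ(½+s/2) = 4ξ'(½+s)ξ(½+s/2) − 2ξ(½+s)ξ'(½+s/2) + Ksξ(½+s)ξ(½+s/2)` at `s₀ = 2w` shows:
  `ξ(½ + w) = 0`, `Re w > 0` ⇒ `ξ(½ + 2w) = 0` (multiplicities are equal along the dyadic orbit);
* `noDoublingChain` (below, from the planner's skeleton): iterating, `ξ(½ + 2^k w) = 0` for all `k`,
  but `Re(½ + 2^k w) ≥ 1` for large `k` contradicts `riemannXi_ne_zero_of_one_le_re`;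
* composition: no zero of `ξ(½ + ·)` in `Re > 0`, i.e. none of `ζ` in `½ < Re s < 1`
  (`riemannXi_eq_zero_iff_holds`), which is RH (`quasiRiemannHypothesis_one_half_iff_holds`).
-/

-- `Summit.RiemannHypothesis.RiemannHypothesis.…` repeats a component by the tree's layout (D-0017).
set_option linter.dupNamespace false

noncomputable section

open Complex Set MeasureTheory

namespace Summit.RiemannHypothesis.RiemannHypothesis.Theorems

open Literature.NumberTheory.LFunctions
open Summit.RiemannHypothesis.RiemannHypothesis.Theorems.ScrewSquaringLaw
  (stub_landauAbscissa stub_doubling)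

/-- Real part of `2^k · w`. -/
theorem ScrewSquaringLaw.re_two_pow_mul (k : ℕ) (w : ℂ) :
    ((2 : ℂ) ^ k * w).re = (2 : ℝ) ^ k * w.re := by
  have h : (2 : ℂ) ^ k = (((2 : ℝ) ^ k : ℝ) : ℂ) := by push_cast; rfl
  rw [h, Complex.re_ofReal_mul]

/-- **No doubling chain**: a doubling-closed set of zeros of `ξ(½ + ·)` inside `Re w > 0` is empty,
because `½ + 2^k w` has real part `≥ 1` for large `k` and `ξ` does not vanish there
(`riemannXi_ne_zero_of_one_le_re`).  (Planner rh-idea-7's lemma from the registered skeleton.) -/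
theorem ScrewSquaringLaw.noDoublingChain
    (h : ∀ w : ℂ, 0 < w.re → riemannXi (1 / 2 + w) = 0 → riemannXi (1 / 2 + 2 * w) = 0) :
    ∀ w : ℂ, 0 < w.re → riemannXi (1 / 2 + w) ≠ 0 := by
  intro w hw hzero
  have iter : ∀ k : ℕ, riemannXi (1 / 2 + (2 : ℂ) ^ k * w) = 0 := by
    intro k
    induction k with
    | zero => simpa using hzero
    | succ k ih =>
      have hk : 0 < ((2 : ℂ) ^ k * w).re := by rw [ScrewSquaringLaw.re_two_pow_mul]; positivity
      have h' := h _ hk ih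
      rw [show (2 : ℂ) ^ (k + 1) * w = 2 * ((2 : ℂ) ^ k * w) by ring]
      exact h'
  obtain ⟨k, hk⟩ : ∃ k : ℕ, 1 / (2 * w.re) < (2 : ℝ) ^ k := pow_unbounded_of_one_lt _ one_lt_two
  have hpos : 0 < 2 * w.re := by positivity
  have hprod : 1 < (2 : ℝ) ^ k * (2 * w.re) := by
    calc (1 : ℝ) = 1 / (2 * w.re) * (2 * w.re) := by field_simp
      _ < (2 : ℝ) ^ k * (2 * w.re) := mul_lt_mul_of_pos_right hk hpos
  have hre : 1 ≤ (1 / 2 + (2 : ℂ) ^ k * w).re := by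
    rw [Complex.add_re, ScrewSquaringLaw.re_two_pow_mul]
    norm_num
    nlinarith
  exact riemannXi_ne_zero_of_one_le_re hre (iter k)

/-- **Crux `ScrewSquaringLaw.DyadicLandau` (stmt-RiemannHypothesis-23894), dyadic Landau detection
(RH-free):** if `Ψ(2t) ≤ 4Ψ(t) + K` for some `K` and all `t ≥ 0`, `Ψ` Suzuki's screw function of `ζ`,
then the Riemann Hypothesis holds.  Landau abscissa (`stub_landauAbscissa`) ⇒ doubling of off-line
zeros (`stub_doubling`) ⇒ no off-line zeros (`noDoublingChain`) ⇒ RH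
(`quasiRiemannHypothesis_one_half_iff_holds`).  A criterion, not a proof of RH. -/
theorem DyadicLandau_proof :
    Summit.RiemannHypothesis.RiemannHypothesis.Theses.ScrewSquaringLaw.DyadicLandau := by
  unfold Summit.RiemannHypothesis.RiemannHypothesis.Theses.ScrewSquaringLaw.DyadicLandau
  rintro ⟨K, hK⟩
  have hno : ∀ w : ℂ, 0 < w.re → riemannXi (1 / 2 + w) ≠ 0 :=
    ScrewSquaringLaw.noDoublingChain (stub_doubling K (stub_landauAbscissa K hK))
  refine quasiRiemannHypothesis_one_half_iff_holds.1 fun s hs h1' h2' ↦ ?_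
  have hξ : riemannXi s = 0 := (riemannXi_eq_zero_iff_holds s).2 ⟨hs, by linarith, h2'⟩
  have hw : 0 < (s - 1 / 2).re := by simp; linarith
  refine hno (s - 1 / 2) hw ?_
  rw [show (1 / 2 : ℂ) + (s - 1 / 2) = s by ring]
  exact hξ

end Summit.RiemannHypothesis.RiemannHypothesis.Theorems

end
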